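import Mathlib
import Literature.MathematicalPhysics.QuantumFieldTheory.Balaban1983to89.B12
import Literature.MathematicalPhysics.QuantumFieldTheory.Balaban1983to89.B13
import Literature.MathematicalPhysics.QuantumFieldTheory.Balaban1983to89.Step
import Literature.MathematicalPhysics.QuantumFieldTheory.Balaban1983to89.B12Beta

/-!
# `Balaban1983to89.B12Sec2to5` — T. Bałaban, *Renormalization group approach to lattice gauge field theories. I.
Generation of effective actions in a small field approximation and a coupling constant renormalization in four
dimensions*, Commun. Math. Phys. **109**, 249–301 (1987) [Balaban1987RG1], **Sections 2–5** (journal pp. 264–298;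
PDF page = journal page − 248; PDF held: `paper:balaban1987-cmp109-rg-i-small-field`).

CITATION HEADER (lean-in-tree rule 2026-08-18).  This module is a TYPED SKELETON (statement level) of §§2–5 of the
published paper [Balaban1987RG1] (cell paper B12), companion to `…Balaban1983to89.B12` (§§0–1, Theorems 1–3) and
`…Balaban1983to89.B13` (paper II, which closes Theorem 3).  It was written from a line-by-line reading of the 300-dpi
renders of pp. 264–301 (unit `b2b-balaban-b03`, phase-2 row P12b; prose transcript with every displayed formula
(2.1)–(5.44): `HOME/b2b-balaban-b03/B12s-transcript.md`; section census in `HOME/GAPS.md` rows `G-B12s-*` / `C-B12s-*`).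
WHAT IS REPRODUCED, and nothing else:
* §2 (pp. 265–269): the REDUCTION of Theorem 3 to the new term (2.13) — p. 268 *"The equalities (2.12), (2.14) together
  with the definitions (2.13), (2.15) imply that the action A_{k+1} is given by (1.3) with k+1 instead of k. By the
  inductive assumption, and by the properties of the expressions given by explicit formulas, all terms in this
  representation satisfy the required properties, except possibly the last term (2.13) in the sum."* and p. 269 *"Thus
  the proof of Theorem 3 is reduced to proving the remaining properties of (2.13), i.e. to a construction of the
  representation (1.7) with terms having the analytic extensions satisfying the bound (1.18)."* — typed as
  `Sec2Reduction` over the carrier `B12.RunData`, with the kernel-checked bookkeeping `smallFieldStep_of_sec2`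
  (§2 reduction + delivery of the new term ⇒ `B13.SmallFieldStep`) and `thm3_inner_of_sec2`.
* §3 (pp. 269–281): the ONLY numbered statement of §§2–5, **Lemma 4** (p. 280, (3.53)), typed VERBATIM over a schematic
  frame `Lemma4Frame` (the configuration spaces U′ᶜ_{k+1}(□₀, a₀, a₁), Uᶜ_j(X, α₀, α₁) of §1 (i)–(iv) and the composite
  map (3.26)–(3.30), (3.53) are abstract carriers — DIVERGENCE D-b03.1), together with the printed list of *"all the
  restrictions"* on α₀, α₁, α₃, β (pp. 277–280) as `Lemma4Restrictions`, and the kernel-checked arithmetic of the chain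
  (3.46)–(3.47), (3.51)–(3.52) (`scale_sq_le`, `ineq351`, `ineq352_closes`) by which the enlarged constants (1 + cβ)α₀ are
  mapped back inside α₀ by the factor L⁻² — the mechanism of the analytic extension.
* §5 (pp. 292–298): the β-function.  p. 297 (5.42) verbatim: *"β = −(∂²/∂p₁∂p₂ Π̃₁₂)(0) = −(∂²/∂p_μ∂p_ν Π̃_{μν})(0) =
  Σ_x Π_{μν}(x) x_μ x_ν for μ ≠ ν. This is the fundamental equality defining the β-function."*; p. 298: *"Defining the
  function β_j as equal to the coefficient β in (5.43) …"*, *"In fact we should write the superscript (j) at the tensor in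
  the formula (5.42) defining the function β_j. We write β_j as explicitly dependent on g_{j−1}, although it depends also
  on all preceding coupling constants."*; and (5.10) p. 293: *"|Π_{μν}(x − y)| ≤ O(1)E₀ exp(−δ₁|x − y|), (5.10) with a
  positive constant δ₁ determined by δ₀, κ, and M (e.g., δ₁ = 1/2min{δ₀, κM⁻¹})"* (typed with the example value).  The
  right member of (5.42) = (1.22) is `B12Beta.secondMoment` (P12a sub-cell, landed); typed
  here: `Decay510` (the input (5.10) for one component kernel), and the KERNEL-CHECKED consequence the paper leaves
  implicit: (5.10) + (5.42) ⇒ the lattice sum (1.22)/(5.42) converges absolutely and |β_j| ≤ O(1)E₀ · Σ_{x∈ℤᵈ} |x|₁²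
  e^{−δ₁|x|₁} =: β′ uniformly in j (`majorant_summable`, `secondMoment_abs_le_of_decay510`), i.e. exactly the hypothesis
  `Step.BetaUpper β′` (and `Step.BetaLower (−β′)`, NOT a positive lower bound) of the cell's Theorem-2 bookkeeping
  (`betaUpper_of_decay510`, `betaLower_neg_of_decay510`, `betaBound_Icc_of_decay510` in the shape of
  `Step.SFHyp.betaBound`, and `thm2Conclusion_of_split_of_decay510` = `B12Beta.thm2Conclusion_of_split` with its
  upper-bound hypothesis discharged by (5.10)).
WHAT §§2–5 DO NOT CONTAIN (recorded, not typed as theorems): no sign, no positive lower bound, no one-loop asymptotics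
and no g-derivative bound for β_j (p. 264's "smooth … uniformly bounded … together with all derivatives. We will
investigate other properties in a separate paper"; p. 251 "The analysis of the Callan–Symanzik equations … will be
discussed in another paper") — see `HOME/GAPS.md` G-adv2-3, G-B12s-*; the Ward–Takahashi identities (4.9)–(4.15) and the
representation (5.16)/(5.37) Π̃_{μν}(p) = β(δ_{μν}Δ(p) − ∂̄_μ(p)∂_ν(p)) + Π̃′_{μν}(p) with (5.44) are displayed DERIVATIONS,
not numbered statements; they are transcribed and audited in the census, not typed here (no functional-derivative /
lattice-Fourier carrier in the cell vocabulary).  NOTHING of the series is asserted: every `def … : Prop` below is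
consumed downstream only as a hypothesis, every `theorem` is kernel-checked bookkeeping / elementary analysis.
The (1.20)–(1.22) DEFINITION block of β_{j+1} (the same formula as (5.42), §1 p. 264) is the P12a sub-cell's module
`B12Beta` (`Kernel`, `secondMoment`, `PermCovariant`), imported; this module adds only what §§2–5 add to it.
-/

namespace Literature.MathematicalPhysics.QuantumFieldTheory.Balaban1983to89.B12Sec2to5

open Literature.MathematicalPhysics.QuantumFieldTheory.Balaban1983to89
open _root_.Real _root_.Finset

/-! ## §2 (pp. 265–269 [PDF 17–21]) — the reduction of Theorem 3 to the new term (2.13) -/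

/-- **§2 reduction**, p. 268 [20] – p. 269 [21], verbatim: *"The equalities (2.12), (2.14) together with the definitions
(2.13), (2.15) imply that the action A_{k+1} is given by (1.3) with k+1 instead of k. By the inductive assumption, and
by the properties of the expressions given by explicit formulas, all terms in this representation satisfy the required
properties, except possibly the last term (2.13) in the sum."* … *"Thus the proof of Theorem 3 is reduced to proving the
remaining properties of (2.13), i.e. to a construction of the representation (1.7) with terms having the analytic
extensions satisfying the bound (1.18)."*  Over the carrier `B12.RunData` (`IndAss k` = "A_k satisfies (1.1)–(1.22)"),
with `NewTerm (k+1)` := "E^{(k+1)} defined by (2.13) has the representation (1.7) with terms analytic on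
Uᶜ_{k+1}(X, α₀, α₁) satisfying (1.18) (and (1.19))" entered as an abstract predicate (its content = §§3–5 here + Lemmas
1–3 of [Balaban1988RG2Cluster]): for every step k < K inside the coupling interval, the inductive assumptions at k and
the new-term property at k+1 give the inductive assumptions at k+1. [cite: Balaban1987RG1, §2 pp.268–269] -/
def Sec2Reduction (D : B12.RunData) (NewTerm : ℕ → Prop) (K : ℕ) (γ : ℝ) : Prop :=
  ∀ k, k < K → D.flow.InInterval γ (k + 1) → D.IndAss k → NewTerm (k + 1) → D.IndAss (k + 1)

/-- What the rest of the paper and [II] must deliver (p. 269 [21] "the rest of the paper is almost completely devoted to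
these problems"; [Balaban1988RG2Cluster] p. 22 "completes the proof of the inductive assumptions for the term
E^{(k+1)}"): the new-term property at every step inside the interval, given the inductive assumptions so far.
[cite: Balaban1987RG1, §2 p.269] -/
def NewTermDelivered (D : B12.RunData) (NewTerm : ℕ → Prop) (K : ℕ) (γ : ℝ) : Prop :=
  ∀ k, k < K → D.flow.InInterval γ (k + 1) → D.IndAss k → NewTerm (k + 1)

/-- Bookkeeping (the edge §2 → [II]): the §2 reduction together with the delivery of the new-term property IS the
small-field inductive step `B13.SmallFieldStep` consumed by `B13.indAss_all` / `B13.thm3_inner_of_step`.  Pure logic. [folklore] -/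
theorem smallFieldStep_of_sec2 (D : B12.RunData) (NewTerm : ℕ → Prop) (K : ℕ) (γ : ℝ)
    (hred : Sec2Reduction D NewTerm K γ) (hnew : NewTermDelivered D NewTerm K γ) :
    B13.SmallFieldStep D K γ :=
  fun k hk hI hA => hred k hk hI hA (hnew k hk hI hA)

/-- Bookkeeping toward `B12.Thm3Printed` (innermost clause, fixed admissible constants): §2 reduction + new-term delivery
for every run + the first step ⇒ the inductive assumptions at all k ≤ K for every run in the interval
(via `B13.thm3_inner_of_step`). [folklore] -/
theorem thm3_inner_of_sec2 (C : B12.Consts3 → B12.Construction) (c : B12.Consts3) (γ : ℝ)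
    (NewTerm : B12.RunParams → ℕ → Prop)
    (h0 : ∀ P : B12.RunParams, (C c P).flow.InInterval γ P.K → (C c P).IndAss 0)
    (hred : ∀ P : B12.RunParams, Sec2Reduction (C c P) (NewTerm P) P.K γ)
    (hnew : ∀ P : B12.RunParams, NewTermDelivered (C c P) (NewTerm P) P.K γ) :
    ∀ P : B12.RunParams, (C c P).flow.InInterval γ P.K → ∀ k, k ≤ P.K → (C c P).IndAss k :=
  B13.thm3_inner_of_step C c γ h0 (fun P => smallFieldStep_of_sec2 (C c P) (NewTerm P) P.K γ (hred P) (hnew P))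

/-- **(2.15)** p. 268 [20], verbatim: *"Finally we perform the coupling constant renormalization 1/g_k² = 1/g_{k+1}² +
β_{k+1}(g_k) with the β-function defined by the formulas (1.20), (1.22) for j = k."* — in the tree this is
`Flow.SatisfiesRG` (= `Step.RGEq`, `Step.rgEq_iff`); recorded here as the §2 locus. [cite: Balaban1987RG1, (2.15) p.268] -/
theorem eq215_is_rgEq (F : Flow) (K : ℕ) : F.SatisfiesRG K ↔ Step.RGEq K F.β F.g := Step.rgEq_iff F K

/-! ## §3 (pp. 269–281 [PDF 21–33]) — Lemma 4 (p. 280) and the arithmetic of the analytic extension -/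

/-- Schematic carriers for Lemma 4 (surge node T09.4).  The cell vocabulary has no type for the spaces of regular complex
configurations U′ᶜ_{k+1}(□₀, a₀, a₁) (conditions (i)–(iv) of §1 pp. 261–263 on the cube □₀ = □̃⁵) and Uᶜ_j(X, α₀, α₁), nor
for the composite map of (3.26)–(3.30), (3.53); they enter as abstract data (DIVERGENCE D-b03.1):
`CfgU` = configurations 𝐔 (with 𝐉) near □₀; `CfgA` = the fields 𝐀 on □₀; `CfgB` = fluctuation fields B′ on the bonds
"connected with the definition of U_j(□₀, ·)"; `CfgUJ` = pairs (U, J) restricted to the localization domain X ⊂ □̃²;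
`Uprime a₀ a₁` = U′ᶜ_{k+1}(□₀, a₀, a₁) (third constant γ₀ = α₀ omitted as in print); `A331` = the set of 𝐀 satisfying
(3.31); `normB` = sup |B′|; `Ucj α₀ α₁` = Uᶜ_j(X, α₀, α₁); `comp 𝐔 𝐀 τ B′` = (U_j(□₀, exp i(τB + B′)),
J_j(□₀, exp i(τB + B′)))|_X with B = Q(ηA), A = A(𝐀, 𝐇_{k+1}(□₀, (1/i) log V(𝐔))) of (3.26)–(3.30), τ ∈ [0,1] from
(3.34); `analyticOn a₀ a₁ a₃` = "these functions are analytic on U′ᶜ_{k+1}(□₀, a₀, a₁) × (3.31) × {|B′| < a₃}".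
[cite: Balaban1987RG1, §1 (i)–(iv) pp.261–263 and §3 (3.26)–(3.31), (3.53) pp.275–280] -/
structure Lemma4Frame where
  CfgU : Type
  CfgA : Type
  CfgB : Type
  CfgUJ : Type
  Uprime : ℝ → ℝ → Set CfgU
  A331 : Set CfgA
  normB : CfgB → ℝ
  Ucj : ℝ → ℝ → Set CfgUJ
  comp : CfgU → CfgA → ℝ → CfgB → CfgUJ
  analyticOn : ℝ → ℝ → ℝ → Prop

/-- The constants entering *"for α₀, α₁, α₂, α₃ sufficiently small and satisfying all the restrictions"* (Lemma 4):
`B₃` = the constant of [Balaban1985Variational] Sect. G / Prop. 9 (p. 277 (3.37)); `O₁` = the unnamed absolute "O(1)"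
of (3.37)–(3.43); `M`, `L` as in §0; `β₀ < 1` = the upper end of the Hölder range of (3.28)/(3.31); `β` = the Hölder
exponent / enlargement parameter of §3 (NOT the β-function — notation remark N-β of the census). [cite: Balaban1987RG1, §3 pp.277–280] -/
structure Lemma4Consts where
  B₃ : ℝ
  O₁ : ℝ
  M : ℝ
  L : ℝ
  β₀ : ℝ
  β : ℝ
  α₀ : ℝ
  α₁ : ℝ
  α₂ : ℝ
  α₃ : ℝ

/-- *"all the restrictions"* of Lemma 4, verbatim from the proof, pp. 275–280 [27–32]: pp. 275–276 (3.28)/(3.31) "for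
0 ≤ β ≤ β₀ < 1" (the Hölder range of [Balaban1985Variational] Sect. F; here with β > 0, which the gain (L^jη)^β on p. 288
needs — census G-B12s-11); p. 277 *"Assume now that B₃²O(1)Mα₀ < ½α₁"*;
p. 278–279 *"We assume that (4B₃²O(1)M)²α₀ ≤ β. This second restriction is not essentially stronger than the first
one, because we have already assumed the restriction O(1)Mα₁ ≤ β on α₁"*; p. 280 *"if B₃α₃ < ½α₁"*, *"where we have
assumed 2B₃α₃ ≤ βL⁻²α₀"*, and p. 279/280 *"(1+7β)L⁻² ≤ 1 for β not too large"* / (3.52) ⇒ (iii) needs (1+8β)L⁻² ≤ 1.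
(The ε₁- and α₂-smallness conditions of (3.14)/(3.31) concern 𝐀 and are inside `Lemma4Frame.A331`.) [cite: Balaban1987RG1, §3 pp.276–280] -/
def Lemma4Restrictions (c : Lemma4Consts) : Prop :=
  0 < c.α₀ ∧ 0 < c.α₁ ∧ 0 < c.α₂ ∧ 0 < c.α₃ ∧ 0 < c.β ∧ c.β ≤ c.β₀ ∧ c.β₀ < 1 ∧ 1 < c.L ∧
  c.B₃ ^ 2 * c.O₁ * c.M * c.α₀ < c.α₁ / 2 ∧
  (4 * c.B₃ ^ 2 * c.O₁ * c.M) ^ 2 * c.α₀ ≤ c.β ∧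
  c.O₁ * c.M * c.α₁ ≤ c.β ∧
  c.B₃ * c.α₃ < c.α₁ / 2 ∧
  2 * c.B₃ * c.α₃ ≤ c.β * c.L⁻¹ ^ 2 * c.α₀ ∧
  1 + 8 * c.β ≤ c.L ^ 2

/-- **Lemma 4** (p. 280 [32]), verbatim: *"For 𝐔 ∈ U′ᶜ_{k+1}(□₀, (1+2β)α₀, (1+2β)α₁), 𝐀 defined on □₀ and satisfying
(3.31), B′ defined on the set of bonds connected with the definition of U_j(□₀, ·) and satisfying |B′| < α₃, we have
  (U_j(□₀, exp i(τB + B′)), J_j(□₀, exp i(τB + B′)))|_X ∈ Uᶜ_j(X, α₀, α₁)   (3.53)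
for α₀, α₁, α₂, α₃ sufficiently small and satisfying all the restrictions. The functions in (3.53) are analytic on the
above spaces."*  Context fixed by the proof (pp. 275–280): X ∈ 𝐃_j with X ⊂ □̃² (the "fundamental case" p. 275),
□₀ = □̃⁵, 1 ≤ j ≤ k, τ ∈ [0, 1] (from the Taylor formula (3.34)), B = Q(ηA) as in (3.30).  Typed over `Lemma4Frame`
(schematic carriers, D-b03.1); "sufficiently small and satisfying all the restrictions" = the hypothesis
`Lemma4Restrictions c` plus an unprinted absolute smallness threshold `a` on α₀, α₁, α₂, α₃ (∃ a > 0, stated for all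
constants below it). [cite: Balaban1987RG1, Lemma 4 (3.53) p.280] -/
def Lemma4Printed (F : Lemma4Frame) (c : Lemma4Consts) : Prop :=
  Lemma4Restrictions c →
    (∀ (U : F.CfgU) (A : F.CfgA) (τ : ℝ) (B' : F.CfgB),
        U ∈ F.Uprime ((1 + 2 * c.β) * c.α₀) ((1 + 2 * c.β) * c.α₁) → A ∈ F.A331 → 0 ≤ τ → τ ≤ 1 →
          F.normB B' < c.α₃ → F.comp U A τ B' ∈ F.Ucj c.α₀ c.α₁) ∧
      F.analyticOn ((1 + 2 * c.β) * c.α₀) ((1 + 2 * c.β) * c.α₁) c.α₃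

/-- The form in which Lemma 4 is printed ("for α₀, α₁, α₂, α₃ sufficiently small"): there is an absolute threshold below
which the restricted constants give (3.53).  [cite: Balaban1987RG1, Lemma 4 p.280] -/
def Lemma4PrintedSmall (F : ℝ → ℝ → ℝ → ℝ → Lemma4Frame) (B₃ O₁ M L β₀ β : ℝ) : Prop :=
  ∃ a : ℝ, 0 < a ∧ ∀ α₀ α₁ α₂ α₃ : ℝ, α₀ < a → α₁ < a → α₂ < a → α₃ < a →
    Lemma4Printed (F α₀ α₁ α₂ α₃) ⟨B₃, O₁, M, L, β₀, β, α₀, α₁, α₂, α₃⟩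

/-- The scaling gain of §3 (p. 279 [31], between (3.46) and (3.47), verbatim: *"Let us notice that j ≤ k, hence L^jη ≤ 1
and (1+7β)L⁻² ≤ 1 for β not too large"*; used in (3.41), (3.44)–(3.47), (3.51)–(3.52)): for j ≥ 1 and L^jη ≤ 1,
(L^{j−1}η)² ≤ L⁻².  Elementary. [folklore] -/
theorem scale_sq_le {L η : ℝ} {j : ℕ} (hL : 0 < L) (hη : 0 ≤ η) (hj : 1 ≤ j) (hscale : L ^ j * η ≤ 1) :
    (L ^ (j - 1) * η) ^ 2 ≤ L⁻¹ ^ 2 := by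
  have hLj : L ^ j = L * L ^ (j - 1) := by
    rw [← pow_succ']
    congr 1
    omega
  have hnonneg : 0 ≤ L ^ (j - 1) * η := mul_nonneg (pow_nonneg hL.le _) hη
  have h1 : L * (L ^ (j - 1) * η) ≤ 1 := by
    calc L * (L ^ (j - 1) * η) = L ^ j * η := by rw [hLj]; ring
      _ ≤ 1 := hscale
  have hle : L ^ (j - 1) * η ≤ L⁻¹ := by
    calc L ^ (j - 1) * η = L⁻¹ * (L * (L ^ (j - 1) * η)) := by field_simp
      _ ≤ L⁻¹ * 1 := mul_le_mul_of_nonneg_left h1 (inv_pos.mpr hL).le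
      _ = L⁻¹ := mul_one _
  exact pow_le_pow_left₀ hnonneg hle 2

/-- **(3.51)** p. 280 [32], the displayed chain *"< (1+6β)α₀(L^{j−1}η)² + 2B₃α₃ ≤ (1+6β)L⁻²α₀ + 2B₃α₃ ≤ (1+7β)L⁻²α₀ on □̃³,
where we have assumed 2B₃α₃ ≤ βL⁻²α₀"*: both printed inequalities, kernel-checked from the scaling gain and the
restriction. [cite: Balaban1987RG1, (3.51) p.280] -/
theorem ineq351 {L η β α₀ B₃ α₃ : ℝ} {j : ℕ} (hL : 0 < L) (hη : 0 ≤ η) (hj : 1 ≤ j) (hscale : L ^ j * η ≤ 1)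
    (hβ : 0 ≤ β) (hα₀ : 0 ≤ α₀) (hres : 2 * B₃ * α₃ ≤ β * L⁻¹ ^ 2 * α₀) :
    (1 + 6 * β) * α₀ * (L ^ (j - 1) * η) ^ 2 + 2 * B₃ * α₃ ≤ (1 + 6 * β) * L⁻¹ ^ 2 * α₀ + 2 * B₃ * α₃ ∧
      (1 + 6 * β) * L⁻¹ ^ 2 * α₀ + 2 * B₃ * α₃ ≤ (1 + 7 * β) * L⁻¹ ^ 2 * α₀ := by
  have hs := scale_sq_le hL hη hj hscale
  have hc : 0 ≤ (1 + 6 * β) * α₀ := mul_nonneg (by linarith) hα₀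
  constructor
  · have := mul_le_mul_of_nonneg_left hs hc
    nlinarith [this]
  · nlinarith [hres]

/-- **(3.52) ⇒ condition (iii)** p. 280 [32]: *"|∂ exp iξ𝐇_j(…) − 1| < (1+8β)L⁻²α₀ξ² on □̃³. This implies the first
inequality in the condition (iii)"* — i.e. (1+8β)L⁻²α₀ ≤ α₀, which holds exactly when (1+8β) ≤ L² (the restriction
"β not too large", p. 279).  Kernel-checked. [cite: Balaban1987RG1, (3.52) p.280] -/
theorem ineq352_closes {L β α₀ : ℝ} (hL : 0 < L) (hα₀ : 0 ≤ α₀) (hres : 1 + 8 * β ≤ L ^ 2) :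
    (1 + 8 * β) * L⁻¹ ^ 2 * α₀ ≤ α₀ := by
  have hL2 : 0 < L ^ 2 := by positivity
  have h1 : (1 + 8 * β) * L⁻¹ ^ 2 ≤ 1 := by
    rw [inv_pow, ← div_eq_mul_inv, div_le_one hL2]
    exact hres
  calc (1 + 8 * β) * L⁻¹ ^ 2 * α₀ ≤ 1 * α₀ := mul_le_mul_of_nonneg_right h1 hα₀
    _ = α₀ := one_mul _

/-- **(3.17)** p. 272 [24], the Cauchy-estimate constant: *"|(3.15)| ≤ (1/r)E₀ exp(−κd_j(X)) ≤ E₀ exp(−κd_j(X)) 6α₂⁻¹ L^jη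
B₀B₃ × …"* with the radius r chosen on p. 272 so that 1/r = 3α₂⁻¹ · 2L^jηB₀B₃(…): the printed "6" is 3·2.  The
one-variable Cauchy inequality behind it — |f′(0)| ≤ (sup_{|t|=r}|f|)/r for f analytic on |t| ≤ r — is Mathlib's
`Complex.norm_deriv_le_of_forall_mem_sphere_norm_le`; only the arithmetic of the constant is recorded here. [cite: Balaban1987RG1, (3.17) p.272] -/
theorem const317 (α₂ s E : ℝ) : (3 * α₂⁻¹ * (2 * s)) * E = E * (6 * α₂⁻¹ * s) := by ring

/-- The restrictions of Lemma 4 are JOINTLY SATISFIABLE for any B₃, O₁, M > 0, L > 1, β₀ ∈ (0,1) (the census downgraded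
the apparent clash between "β small" uses and "β ≥ O(1)Mα₁" to a notation remark N-β on this ground): explicit
admissible values.  Kernel-checked consistency of the printed hypothesis list, no content of the series. [folklore] -/
theorem lemma4Restrictions_satisfiable (B₃ O₁ M L β₀ : ℝ) (hB : 0 < B₃) (hO : 0 < O₁) (hM : 0 < M) (hL : 1 < L)
    (hβ₀ : 0 < β₀) (hβ₁ : β₀ < 1) :
    ∃ β α₀ α₁ α₂ α₃ : ℝ, Lemma4Restrictions ⟨B₃, O₁, M, L, β₀, β, α₀, α₁, α₂, α₃⟩ := by
  -- β := min β₀ ((L²−1)/8); α₁ := β/(O₁M+1)·… ; we give a uniform construction with one small parameter t.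
  set β : ℝ := min β₀ ((L ^ 2 - 1) / 8) with hβdef
  have hL2 : 1 < L ^ 2 := by nlinarith
  have hβpos : 0 < β := lt_min hβ₀ (by linarith)
  have hβle : β ≤ β₀ := min_le_left _ _
  have hβL : 1 + 8 * β ≤ L ^ 2 := by
    have := min_le_right β₀ ((L ^ 2 - 1) / 8)
    linarith
  -- α₁ := β / (O₁ * M + 1)
  set α₁ : ℝ := β / (O₁ * M + 1) with hα₁def
  have hOM : 0 < O₁ * M + 1 := by positivity
  have hα₁pos : 0 < α₁ := div_pos hβpos hOM
  have hR3 : O₁ * M * α₁ ≤ β := by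
    rw [hα₁def, mul_div_assoc']
    rw [div_le_iff₀ hOM]
    nlinarith [mul_pos hO hM]
  -- α₀ := min (α₁ / (4 * (B₃^2 * O₁ * M) + 1)) (β / ((4 * B₃^2 * O₁ * M)^2 + 1))
  set D₁ : ℝ := 4 * (B₃ ^ 2 * O₁ * M) + 1 with hD₁
  set D₂ : ℝ := (4 * B₃ ^ 2 * O₁ * M) ^ 2 + 1 with hD₂
  have hD₁pos : 0 < D₁ := by positivity
  have hD₂pos : 0 < D₂ := by positivity
  set α₀ : ℝ := min (α₁ / D₁) (β / D₂) with hα₀def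
  have hα₀pos : 0 < α₀ := lt_min (div_pos hα₁pos hD₁pos) (div_pos hβpos hD₂pos)
  have hR1 : B₃ ^ 2 * O₁ * M * α₀ < α₁ / 2 := by
    have hle : α₀ ≤ α₁ / D₁ := min_le_left _ _
    have hK : 0 ≤ B₃ ^ 2 * O₁ * M := by positivity
    have h1 : B₃ ^ 2 * O₁ * M * α₀ ≤ B₃ ^ 2 * O₁ * M * (α₁ / D₁) := mul_le_mul_of_nonneg_left hle hK
    have h2 : B₃ ^ 2 * O₁ * M * (α₁ / D₁) < α₁ / 2 := by
      rw [mul_div_assoc', div_lt_div_iff₀ hD₁pos (by norm_num : (0:ℝ) < 2)]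
      rw [hD₁]
      nlinarith [hα₁pos, hK]
    exact lt_of_le_of_lt h1 h2
  have hR2 : (4 * B₃ ^ 2 * O₁ * M) ^ 2 * α₀ ≤ β := by
    have hle : α₀ ≤ β / D₂ := min_le_right _ _
    have hK : 0 ≤ (4 * B₃ ^ 2 * O₁ * M) ^ 2 := by positivity
    have h1 := mul_le_mul_of_nonneg_left hle hK
    refine le_trans h1 ?_
    rw [mul_div_assoc', div_le_iff₀ hD₂pos, hD₂]
    nlinarith [hβpos, hK]
  -- α₃ := min (α₁ / (4 * B₃ + 1)) (β * L⁻¹ ^ 2 * α₀ / (2 * B₃ + 1))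
  set D₃ : ℝ := 4 * B₃ + 1 with hD₃
  set D₄ : ℝ := 2 * B₃ + 1 with hD₄
  have hD₃pos : 0 < D₃ := by positivity
  have hD₄pos : 0 < D₄ := by positivity
  have hLinv : 0 < L⁻¹ ^ 2 := by
    have : 0 < L := by linarith
    positivity
  have hnum : 0 < β * L⁻¹ ^ 2 * α₀ := by positivity
  set α₃ : ℝ := min (α₁ / D₃) (β * L⁻¹ ^ 2 * α₀ / D₄) with hα₃def
  have hα₃pos : 0 < α₃ := lt_min (div_pos hα₁pos hD₃pos) (div_pos hnum hD₄pos)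
  have hR4 : B₃ * α₃ < α₁ / 2 := by
    have hle : α₃ ≤ α₁ / D₃ := min_le_left _ _
    have h1 : B₃ * α₃ ≤ B₃ * (α₁ / D₃) := mul_le_mul_of_nonneg_left hle hB.le
    have h2 : B₃ * (α₁ / D₃) < α₁ / 2 := by
      rw [mul_div_assoc', div_lt_div_iff₀ hD₃pos (by norm_num : (0:ℝ) < 2), hD₃]
      nlinarith [hα₁pos, hB]
    exact lt_of_le_of_lt h1 h2
  have hR5 : 2 * B₃ * α₃ ≤ β * L⁻¹ ^ 2 * α₀ := by
    have hle : α₃ ≤ β * L⁻¹ ^ 2 * α₀ / D₄ := min_le_right _ _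
    have hK : 0 ≤ 2 * B₃ := by positivity
    have h1 := mul_le_mul_of_nonneg_left hle hK
    refine le_trans h1 ?_
    rw [mul_div_assoc', div_le_iff₀ hD₄pos, hD₄]
    nlinarith [hnum, hB]
  refine ⟨β, α₀, α₁, 1, α₃, ?_⟩
  exact ⟨hα₀pos, hα₁pos, one_pos, hα₃pos, hβpos, hβle, hβ₁, hL, hR1, hR2, hR3, hR4, hR5, hβL⟩

/-! ## §5 (pp. 292–298 [PDF 44–50]) — the β-function: (5.10), (5.42) and the uniform bound they imply -/

/-- The ℓ¹-size |x|₁ = Σ_μ |x_μ| of a lattice vector x ∈ ℤᵈ (as a real number); stands for the unspecified lattice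
distance |x − y| of (5.10) (DIVERGENCE D-b03.4). [folklore] -/
def l1 {d : ℕ} (x : Fin d → ℤ) : ℝ := ∑ μ, |(x μ : ℝ)|

/-- |x|₁ ≥ 0. [folklore] -/
theorem l1_nonneg {d : ℕ} (x : Fin d → ℤ) : 0 ≤ l1 x :=
  Finset.sum_nonneg fun _ _ => abs_nonneg _

/-- |x_μ| ≤ |x|₁. [folklore] -/
theorem abs_coord_le_l1 {d : ℕ} (x : Fin d → ℤ) (μ : Fin d) : |(x μ : ℝ)| ≤ l1 x :=
  Finset.single_le_sum (f := fun κ => |(x κ : ℝ)|) (fun _ _ => abs_nonneg _) (Finset.mem_univ μ)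

/-- **(5.42)** p. 297 [49], verbatim: *"β = −(∂²/∂p₁∂p₂ Π̃₁₂)(0) = −(∂²/∂p_μ∂p_ν Π̃_{μν})(0) = Σ_x Π_{μν}(x) x_μ x_ν
for μ ≠ ν. This is the fundamental equality defining the β-function."* and p. 298 [50]: *"Defining the function β_j as
equal to the coefficient β in (5.43) … In fact we should write the superscript (j) at the tensor in the formula (5.42)
defining the function β_j."*  The right member is LITERALLY the right member of (1.22) p. 264, typed as
`B12Beta.secondMoment` — recorded as a definitional equality (the §5 locus of (1.22)). [cite: Balaban1987RG1, (5.42) p.297] -/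
theorem eq542_is_eq122 {d : ℕ} (P : B12Beta.Kernel d) (μ ν : Fin d) :
    B12Beta.secondMoment P μ ν = ∑' x : Fin d → ℤ, P μ ν x * (x μ : ℝ) * (x ν : ℝ) := rfl

/-- **(5.10)** p. 293 [45], verbatim: *"The representation (4.37) yields the following inequality
|Π_{μν}(x − y)| ≤ O(1)E₀ exp(−δ₁|x − y|), (5.10) with a positive constant δ₁ determined by δ₀, κ, and M (e.g.,
δ₁ = 1/2min{δ₀, κM⁻¹})."* — typed for one component kernel with the constant `C` (= O(1)E₀), a rate `δ₁` (the printed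
example value ½ min{δ₀, κM⁻¹} is `B12Decay510.delta1` of the satellite module deriving (5.10) from its leaves) and the ℓ¹
distance (any lattice norm differs by a factor absorbed in δ₁).  This is the INPUT of §5: print derives it from "the
representation (4.37)" in one word ("yields") — from the inductive bound (1.18) via a Cauchy estimate, the decay of the
linearized minimizers (p. 282) and a polymer sum; census row G-B12s-15.  (REVISION v2, docstring only: v1 quoted here as
verbatim a sentence *"It follows from (1.18) and (5.9) by the usual arguments"* which is NOT printed — cell GAPS G-pv13-4 (1);
the declaration is unchanged.) [cite: Balaban1987RG1, (5.10) p.293] -/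
def Decay510 {d : ℕ} (P : (Fin d → ℤ) → ℝ) (C δ₁ : ℝ) : Prop :=
  ∀ x, |P x| ≤ C * Real.exp (-δ₁ * l1 x)

/-- Pointwise: (5.10) ⇒ |Π(x) x_μ x_ν| ≤ C · |x|₁² e^{−δ₁|x|₁}. [folklore] -/
theorem abs_term_le_of_decay510 {d : ℕ} {P : (Fin d → ℤ) → ℝ} {C δ₁ : ℝ} (h : Decay510 P C δ₁)
    (μ ν : Fin d) (x : Fin d → ℤ) :
    |P x * (x μ : ℝ) * (x ν : ℝ)| ≤ C * (l1 x ^ 2 * Real.exp (-δ₁ * l1 x)) := by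
  rw [abs_mul, abs_mul]
  have h1 := h x
  have h2 := abs_coord_le_l1 x μ
  have h3 := abs_coord_le_l1 x ν
  have hCe : 0 ≤ C * Real.exp (-δ₁ * l1 x) := le_trans (abs_nonneg _) h1
  calc |P x| * |(x μ : ℝ)| * |(x ν : ℝ)| ≤ (C * Real.exp (-δ₁ * l1 x)) * l1 x * l1 x :=
        mul_le_mul (mul_le_mul h1 h2 (abs_nonneg _) hCe) h3 (abs_nonneg _) (mul_nonneg hCe (l1_nonneg x))
    _ = C * (l1 x ^ 2 * Real.exp (-δ₁ * l1 x)) := by ring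

/-- One-dimensional leaf: Σ_{n∈ℤ} e^{−c|n|} < ∞ for c > 0 (geometric series on ℕ and on −ℕ). [folklore] -/
theorem summable_exp_neg_abs_int {c : ℝ} (hc : 0 < c) :
    Summable (fun n : ℤ => Real.exp (-c * |(n : ℝ)|)) := by
  have hnat : Summable (fun n : ℕ => Real.exp (-c * |((n : ℤ) : ℝ)|)) := by
    have heq : (fun n : ℕ => Real.exp (-c * |((n : ℤ) : ℝ)|)) = fun n : ℕ => Real.exp (-c) ^ n := by
      funext n
      rw [Int.cast_natCast, abs_of_nonneg (Nat.cast_nonneg n), ← Real.exp_nat_mul]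
      ring_nf
    rw [heq]
    exact summable_geometric_of_lt_one (Real.exp_pos _).le (Real.exp_lt_one_iff.mpr (by linarith))
  refine summable_int_iff_summable_nat_and_neg.mpr ⟨hnat, ?_⟩
  simpa [abs_neg] using hnat

/-- d-dimensional leaf: Σ_{x∈ℤᵈ} e^{−c|x|₁} < ∞ (product structure, induction on d via `Fin.consEquiv`). [folklore] -/
theorem summable_exp_neg_l1 {c : ℝ} (hc : 0 < c) :
    ∀ d : ℕ, Summable (fun x : Fin d → ℤ => Real.exp (-c * l1 x))
  | 0 => Summable.of_finite
  | d + 1 => by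
    have hprod : Summable (fun p : ℤ × (Fin d → ℤ) =>
        Real.exp (-c * |(p.1 : ℝ)|) * Real.exp (-c * l1 p.2)) :=
      (summable_exp_neg_abs_int hc).mul_of_nonneg (summable_exp_neg_l1 hc d)
        (fun _ => (Real.exp_pos _).le) (fun _ => (Real.exp_pos _).le)
    have heq : (fun x : Fin (d + 1) → ℤ => Real.exp (-c * l1 x)) ∘ (Fin.consEquiv fun _ => ℤ) =
        fun p : ℤ × (Fin d → ℤ) => Real.exp (-c * |(p.1 : ℝ)|) * Real.exp (-c * l1 p.2) := by
      funext p
      simp only [Function.comp_apply, l1, Fin.consEquiv_apply, Fin.sum_univ_succ, Fin.cons_zero, Fin.cons_succ,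
        ← Real.exp_add]
      ring_nf
    exact (Equiv.summable_iff (Fin.consEquiv fun _ => ℤ)).mp (heq ▸ hprod)

/-- Polynomial weight: s² e^{−δ s} ≤ (16/δ²) e^{−(δ/2) s} for s ≥ 0, δ > 0 (from t ≤ eᵗ). [folklore] -/
theorem sq_mul_exp_neg_le {δ s : ℝ} (hδ : 0 < δ) (hs : 0 ≤ s) :
    s ^ 2 * Real.exp (-δ * s) ≤ 16 / δ ^ 2 * Real.exp (-(δ / 2) * s) := by
  have ht : δ * s / 4 ≤ Real.exp (δ * s / 4) := by
    have := Real.add_one_le_exp (δ * s / 4)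
    linarith
  have hs' : s ≤ 4 / δ * Real.exp (δ * s / 4) := by
    rw [div_mul_eq_mul_div, le_div_iff₀ hδ]
    linarith
  have hsq : s ^ 2 ≤ (4 / δ * Real.exp (δ * s / 4)) ^ 2 := pow_le_pow_left₀ hs hs' 2
  have hsq' : (4 / δ * Real.exp (δ * s / 4)) ^ 2 = 16 / δ ^ 2 * Real.exp (δ * s / 2) := by
    rw [mul_pow, ← Real.exp_nat_mul]
    congr 1
    · field_simp; norm_num
    · congr 1; ring
  have hpos : 0 ≤ Real.exp (-δ * s) := (Real.exp_pos _).le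
  calc s ^ 2 * Real.exp (-δ * s) ≤ 16 / δ ^ 2 * Real.exp (δ * s / 2) * Real.exp (-δ * s) :=
        mul_le_mul_of_nonneg_right (hsq.trans_eq hsq') hpos
    _ = 16 / δ ^ 2 * Real.exp (-(δ / 2) * s) := by
        rw [mul_assoc, ← Real.exp_add]
        congr 2
        ring

/-- The majorant of (5.10)·(5.42) is summable on ℤᵈ: Σ_x |x|₁² e^{−δ₁|x|₁} < ∞ (δ₁ > 0). [folklore] -/
theorem majorant_summable {δ₁ : ℝ} (hδ : 0 < δ₁) (d : ℕ) :
    Summable (fun x : Fin d → ℤ => l1 x ^ 2 * Real.exp (-δ₁ * l1 x)) :=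
  Summable.of_nonneg_of_le (fun _ => mul_nonneg (sq_nonneg _) (Real.exp_pos _).le)
    (fun x => sq_mul_exp_neg_le hδ (l1_nonneg x))
    ((summable_exp_neg_l1 (half_pos hδ) d).mul_left (16 / δ₁ ^ 2))

/-- **What §5 proves about β_j, made explicit** (the paper displays (5.10) and (5.42) and leaves the bound implicit;
census C-B12s-β′, cf. G-adv2-3): if the component kernel obeys (5.10) with constant C = O(1)E₀ and rate δ₁ > 0, then the
second moment (5.42) converges absolutely and |β| ≤ C · Σ_{x∈ℤᵈ} |x|₁² e^{−δ₁|x|₁} — a bound depending on E₀, δ₀, κ, M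
only, hence UNIFORM in j.  Kernel-checked (dominated summation). [folklore] -/
theorem secondMoment_abs_le_of_decay510 {d : ℕ} {P : B12Beta.Kernel d} {C δ₁ : ℝ} {μ ν : Fin d}
    (hδ : 0 < δ₁) (h : Decay510 (P μ ν) C δ₁) :
    Summable (fun x : Fin d → ℤ => P μ ν x * (x μ : ℝ) * (x ν : ℝ)) ∧
      |B12Beta.secondMoment P μ ν| ≤ C * ∑' x : Fin d → ℤ, l1 x ^ 2 * Real.exp (-δ₁ * l1 x) := by
  have hS := (majorant_summable hδ d).mul_left C
  have hpt : ∀ x : Fin d → ℤ, ‖P μ ν x * (x μ : ℝ) * (x ν : ℝ)‖ ≤ C * (l1 x ^ 2 * Real.exp (-δ₁ * l1 x)) :=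
    fun x => by rw [Real.norm_eq_abs]; exact abs_term_le_of_decay510 h μ ν x
  refine ⟨Summable.of_norm_bounded hS hpt, ?_⟩
  have := tsum_of_norm_bounded hS.hasSum hpt
  rw [Real.norm_eq_abs] at this
  simpa [B12Beta.secondMoment, tsum_mul_left] using this

/-- The constant β′ of the cell's Theorem-2 bookkeeping that §5 actually yields: β′ = C · Σ_x |x|₁² e^{−δ₁|x|₁}
with C = O(1)E₀ and δ₁ of (5.10) — a function of E₀, δ₀, κ, M only, uniform in the scale j. [folklore] -/
noncomputable def betaPrime510 (d : ℕ) (C δ₁ : ℝ) : ℝ :=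
  C * ∑' x : Fin d → ℤ, l1 x ^ 2 * Real.exp (-δ₁ * l1 x)

/-- **Edge §5 → `Step.BetaUpper`.**  If the β-functions of a flow are given by (5.42) from component kernels Π^{(j)}(g, ·)
(μ ≠ ν fixed) which obey (5.10) uniformly for g in the coupling interval ]0, γ], then `Step.BetaUpper β′ γ` holds with
β′ = `betaPrime510`.  This is the ONE hypothesis of `Step.couplingTrajectory_exists` / `Step.flow_exists_of_betaBounds`
that B12 §5 delivers (modulo its input (5.10)). [folklore] -/
theorem betaUpper_of_decay510 {d : ℕ} (μ ν : Fin d) (Pfam : ℕ → ℝ → B12Beta.Kernel d) (β : ℕ → ℝ → ℝ)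
    {γ C δ₁ : ℝ} (hδ : 0 < δ₁) (hβ : ∀ j g, β j g = B12Beta.secondMoment (Pfam j g) μ ν)
    (hdec : ∀ j g, 0 < g → g ≤ γ → Decay510 (Pfam j g μ ν) C δ₁) :
    Step.BetaUpper (betaPrime510 d C δ₁) γ β := by
  intro j g hg hgγ
  rw [hβ j g]
  exact le_trans (le_abs_self _) (secondMoment_abs_le_of_decay510 hδ (hdec j g hg hgγ)).2

/-- … and the only LOWER bound §5 yields: `Step.BetaLower (−β′) γ` — a two-sided absolute bound, NOT the positive lower
bound b > 0 (asymptotic freedom) that Theorem 2 needs (`Step.BetaLower b`, GAPS G1 / G-adv2-3 (c)). [folklore] -/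
theorem betaLower_neg_of_decay510 {d : ℕ} (μ ν : Fin d) (Pfam : ℕ → ℝ → B12Beta.Kernel d) (β : ℕ → ℝ → ℝ)
    {γ C δ₁ : ℝ} (hδ : 0 < δ₁) (hβ : ∀ j g, β j g = B12Beta.secondMoment (Pfam j g) μ ν)
    (hdec : ∀ j g, 0 < g → g ≤ γ → Decay510 (Pfam j g μ ν) C δ₁) :
    Step.BetaLower (-betaPrime510 d C δ₁) γ β := by
  intro j g hg hgγ
  rw [hβ j g]
  exact neg_le_of_abs_le (secondMoment_abs_le_of_decay510 hδ (hdec j g hg hgγ)).2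

/-- The same bound in the shape of the clause `Step.SFHyp.betaBound` (closed interval [0, γ], absolute value):
∀ g ∈ [0, γ], |β_j(g)| ≤ β′. [folklore] -/
theorem betaBound_Icc_of_decay510 {d : ℕ} (μ ν : Fin d) (Pfam : ℕ → ℝ → B12Beta.Kernel d) (β : ℕ → ℝ → ℝ)
    {γ C δ₁ : ℝ} (hδ : 0 < δ₁) (hβ : ∀ j g, β j g = B12Beta.secondMoment (Pfam j g) μ ν)
    (hdec : ∀ j g, 0 ≤ g → g ≤ γ → Decay510 (Pfam j g μ ν) C δ₁) :
    ∀ j, ∀ g ∈ Set.Icc (0:ℝ) γ, |β j g| ≤ betaPrime510 d C δ₁ := by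
  intro j g hg
  rw [hβ j g]
  exact (secondMoment_abs_le_of_decay510 hδ (hdec j g hg.1 hg.2)).2

/-- **Edge §5 → Theorem 2 bookkeeping** (`B12Beta.thm2Conclusion_of_split`, Markov typing): of the hypotheses of that
theorem, the upper bound `Step.BetaUpper β′ γ βM` is the one §5 supplies — here discharged by (5.42) + (5.10) with
β′ = `betaPrime510`; the one-loop split (AF-0)/(AF-1) and the continuity of the remainders stay hypotheses (their proofs
are not in print: GAPS G-b12-1/2, G-adv2-3).  Kernel-checked composition, nothing asserted. [folklore] -/
theorem thm2Conclusion_of_split_of_decay510 {d : ℕ} (μ ν : Fin d) (Pfam : ℕ → ℝ → B12Beta.Kernel d)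
    (βM : ℕ → ℝ → ℝ) (β0 : ℕ → ℝ) (r : ℕ → ℝ → ℝ) {b C γ C' δ₁ : ℝ}
    (hγ0 : 0 < γ) (hb : 0 < b)
    (hsplit : ∀ j x, βM j x = β0 j + r j x) (hAF0 : ∀ j, 2 * b ≤ β0 j)
    (hAF1 : ∀ j x, 0 < x → x ≤ γ → |r j x| ≤ C * x) (hC : 0 ≤ C) (hγ : C * γ ≤ b)
    (hcont : ∀ j, ContinuousOn (r j) (Set.Ioc 0 γ))
    (hδ : 0 < δ₁) (hβ : ∀ j g, βM j g = B12Beta.secondMoment (Pfam j g) μ ν)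
    (hdec : ∀ j g, 0 < g → g ≤ γ → Decay510 (Pfam j g μ ν) C' δ₁) :
    ∀ (K : ℕ) (g : ℝ), 0 < g → g ≤ γ →
      ∃ gs : ℕ → ℝ, gs K = g ∧ Step.RGEq K βM gs ∧ Step.InInterval γ K gs ∧
        Step.Discrete031 b (betaPrime510 d C' δ₁) K g gs :=
  B12Beta.thm2Conclusion_of_split βM β0 r hγ0 hb hsplit hAF0 hAF1 hC hγ
    (betaUpper_of_decay510 μ ν Pfam βM hδ hβ hdec) hcont

/-- **(5.35) ⇒ (5.36) on the diagonal** (p. 296–297 [48–49]): with all off-diagonal coefficients β_{μκ} (κ ≠ μ) equal to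
a common value b (symmetry (5.32)) and β_{μμ} arbitrary, the μμ-entry of (5.35),
−β_{μμ}m_μ + Σ_κ β_{μκ}m_κ (m_κ := (z_κ⁻¹ − 1)(z_κ − 1)), equals b(Σ_κ m_κ − m_μ) = the μμ-entry of (5.36): the
diagonal coefficient β_{μμ} DROPS OUT, so only β := 2^{d−2}β_{μν} (μ ≠ ν) enters (5.37) (census C-B12s-05b; confirms
C-adv2-1).  d = 4. [cite: Balaban1987RG1, (5.35)–(5.36) pp.296–297] -/
theorem diag536 (m : Fin 4 → ℝ) (b βdiag : ℝ) (μ : Fin 4) :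
    -βdiag * m μ + ∑ κ, (if κ = μ then βdiag else b) * m κ = b * (∑ κ, m κ - m μ) := by
  fin_cases μ <;> simp [Fin.sum_univ_four] <;> ring

end Literature.MathematicalPhysics.QuantumFieldTheory.Balaban1983to89.B12Sec2to5
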